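import Literature.Analysis.FluidPDE.DeRosaPertTransportErrorProof
import HarnessLib

/-!
# The BDSV scheme: the transport error estimate holds (`BDSV.transportErrorEstimate_holds`)

Buckmaster–De Lellis–Székelyhidi–Vicol, *Onsager's conjecture for admissible weak solutions*,
CPAM 72 (2019) = arXiv:1701.08678, §6.1.2 (arXiv (6.8)): the transport error
`ℛ(∂ₜw_{q+1} + (v̄_q·∇)w_{q+1})` is bounded in `C^{0,α}` by `δ_{q+1}^{1/2} δ_q^{1/2} λ_q λ_{q+1}^{-(1-4α)}`.
The tree's named fact `BDSV.transportErrorEstimate` (`OnsagerBDSVStressSplit.lean`) was left open by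
`OnsagerBDSVTransportSplit.lean` ("What is not here"). It follows at once from the estimate proved
under the WEAKER core hypotheses of the De Rosa port, `DeRosa.transportError_stageFact`
(`DeRosaPertTransportErrorProof.lean`, the Calderón–Zygmund route of the curl form): the BDSV
standing hypotheses with constant `C_in` imply those with `|C_in|`
(`BDSV.PerturbationHypotheses.mono_const`), which imply `DeRosa.CoreHypotheses`
(`DeRosa.CoreHypotheses.ofBDSV`).

## References

* T. Buckmaster, C. De Lellis, L. Székelyhidi Jr., V. Vicol, CPAM 72 (2019) 229–274 =
  arXiv:1701.08678, §6.1.2 (arXiv (6.8)), Prop. 6.1 (6.1).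
-/

open Set
open scoped NNReal

noncomputable section

namespace Literature.Analysis.FluidPDE

namespace BDSV

/-- **The BDSV transport error estimate holds** (§6.1.2, arXiv (6.8), with the exponent
`λ_{q+1}^{-(1-4α)}` of Prop. 6.1 (6.1)): `BDSV.transportErrorEstimate`. Proof: the De Rosa-port
estimate `DeRosa.transportError_stageFact` at the constant `|C_in|`, reached from the BDSV standing
hypotheses through `PerturbationHypotheses.mono_const` and `DeRosa.CoreHypotheses.ofBDSV`.
[cite: BuckmasterEtAl2018, §6.1.2 (arXiv (6.8)) with Prop. 6.1 (6.1)] -/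
theorem transportErrorEstimate_holds : transportErrorEstimate := by
  intro 𝔚 c₀ hc₀ Cη β hβ hβ' b hb hb'
  obtain ⟨α₀, hα₀, h⟩ := DeRosa.transportError_stageFact 𝔚 c₀ hc₀ Cη β hβ hβ' b hb hb'
  refine ⟨α₀, hα₀, fun α hα hαlt => ?_⟩
  obtain ⟨Nbar, h⟩ := h α hα hαlt
  refine ⟨Nbar, fun Cin C₀ => ?_⟩
  obtain ⟨C, a₀, ha₀, h⟩ := h |Cin| C₀
  refine ⟨C, a₀, ha₀, fun a ha S H 𝒟 => ?_⟩
  have ha1 : (1 : ℝ) ≤ a := ha₀.le.trans ha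
  exact h a ha S (DeRosa.CoreHypotheses.ofBDSV (H.mono_const ha1 (le_abs_self Cin)) (abs_nonneg Cin) ha1) 𝒟

end BDSV

end Literature.Analysis.FluidPDE
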